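import Literature.Geometry.Lorentzian.KerrFarLeafEnergy
import Literature.Geometry.Lorentzian.KerrSchildEnergyEstimate
import HarnessLib

/-!
# The far-region inequality for a general cut-off current between a lower graph and a leaf
# `Σ̃_t(h♯_{R₁})` of subextremal Kerr, with a smeared time cut-off: from pointwise bounds on the
# divergence, the plate density and the leaf densities to an inequality of `[0, ∞]`-valued
# integrals

(family `gr`; the common engine of the far-region `r^p`-weighted, Morawetz and `∂_{t*}`-energy
estimates behind statement **gr.S24** — the named fact `Kerr.dafermosRodnianski_pHierarchy_scri`
of `KerrDecayHierarchy.lean`; Dafermos–Rodnianski–Shlapentokh-Rothman, arXiv:1402.7034 = Ann. of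
Math. 183 (2016), §2.3.2 and Remark 2.3.1; Moschidis, arXiv:1509.08489, §4–§5; namespace
`Literature.Geometry.Lorentzian.Kerr`)

`KerrFarLeafEnergy.lean` runs the divergence identity of `KerrSchildTruncatedCurrent.lean` for the
cut-off `∂_{t*}`-current `f J^T[ψ̃]` of an admissible wave and converts it, through pointwise sign
and comparison statements, into an inequality between `[0, ∞]`-valued integrals, the smeared time
cut-off being removed afterwards by monotone convergence. The `r^p`-weighted and Morawetz estimates
of the far region (Moschidis, Thm. 5.1, Lemma 4.1) have exactly the same shape, for other currents.
This file performs that conversion **once, for an arbitrary current** `J = (J^μ)` on `ℝ⁴` attached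
to a function `Φ` on `ℝ⁴` (the extension by zero `ψ̃` of the admissible wave) — `C¹` on the far region
`{‖x⃗‖ > R_af}` and vanishing at the points where `Φ` vanishes to first order (so that the cut-off
current `f J`, `f(x) = u_{R',R'}(x⃗)`, is a global `C¹` current of spatially compact support below
every time level once `Φ = dΦ = 0` at the points `x⁰ ≥ 0`, `‖x⃗‖ > ρ₀ + x⁰`: finite speed of
propagation, `KerrFarRegionCutoff.lean`) — given **pointwise** bounds at the far points `{‖x⃗‖ ≥ R'}` by
densities `D_g, D_b` (divergence: `D_g − D_b ≤ ∑_μ ∂_μ J^μ`), `P_g, P_b` (plate: `P_g − P_b ≤ −J⁰`),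
`E_g, E_b` (top leaf: `E_g − E_b ≤ −∑_μ J^μ n^{h♯}_μ`), `E_bot` (lower graph:
`−∑_μ J^μ n^{F₁}_μ ≤ E_bot`) and a collar majorant `Coll ≥ |∑_μ J^μ ∂_μ f|`:

* `Kerr.leafWedge F₁ F₂ s t` (definition): the region `{s + F₁(x⃗) < x⁰ ≤ t + F₂(x⃗)}` of the chart
  between the graphs `{x⁰ = s + F₁}` and `{x⁰ = t + F₂}` (the open-closed companion of
  `Kerr.leafSlab` of `KerrDecayHierarchyProofs.lean`, without the restriction to a ball), and the
  passage `E4.lintegral_lintegral_indicator_eq_setLIntegral_leafWedge` from the iterated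
  `(t*, y)`-integrals of `KerrFarRegionCutoff.lean` to set integrals over it;
* `Kerr.fderiv_eq_zero_of_far_support` (**proved**): a function vanishing wherever `(Φ, dΦ) = 0`
  has vanishing differential at the points `x⁰ > 0`, `‖x⃗‖ > ρ₀ + x⁰` (an open set on which it
  vanishes identically);
* `Kerr.far_current_inequality` (**proved**, the engine): for `|a| < M`, `R₁ > 2M`, `R' > R_af`, a
  function `Φ` with support radius `ρ₀` below each time level, a current `J` and densities as above
  (continuous at the far points, vanishing where `(Φ, dΦ) = 0`, the good/bad densities non-negative
  at the far points), a
  `C²` lower height `0 ≤ F₁ ≤ h♯_{R₁}`, `0 ≤ s ≤ t` and a time level `T`, with `χ = Real.smoothTransition`,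
  `f = u_{R',R'}`, `W = leafWedge F₁ h♯ s t`:
  `∫ χ(T−t−h♯) f E_g|_{Σ̃_t} dy + ∫_W χ(T−x⁰) f D_g + ∫_W χ'(T−x⁰) f P_g
     ≤ ∫ χ(T−s−F₁) f E_bot|_{(s+F₁(y),y)} dy + ∫ χ(T−t−h♯) f E_b|_{Σ̃_t} dy + ∫_W χ(T−x⁰) f D_b
       + ∫_W χ'(T−x⁰) f P_b + ∫_W χ(T−x⁰) Coll`
  (all as Lebesgue integrals of `ENNReal.ofReal` of the non-negative integrands; DRSR §2.3.2 with
  the smeared future boundary of `KerrSchildTruncatedCurrent.lean`).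

The `∂_{t*}`-energy inequality of `KerrFarLeafEnergy.lean` is the case `J = J^T[ψ̃]`, `D_g = D_b = 0`,
`P_b = E_b = 0`; the `r^p` and Morawetz estimates feed it with the currents of
`KerrRpDivergence.lean` and `KerrFarMorawetzCoercivity.lean`. No named facts (D-0026).

## References

* M. Dafermos, I. Rodnianski, Y. Shlapentokh-Rothman, arXiv:1402.7034 = Ann. of Math. 183 (2016),
  §2.3.1–§2.3.2 ((ingeneralform), cut-offs: Remark 2.3.1), §3.3, §4.1
  (key `DafermosRodnianskiShlapentokhrothman2014`).
* G. Moschidis, arXiv:1509.08489 = Ann. PDE 2 (2016), §4 (Lemmas 4.1, 4.5), §5 (Thm. 5.1: the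
  regions `𝓡(τ₁, τ₂) ∩ {t ≤ T*}` and the `lim sup_{T* → ∞}`) (key `Moschidis2016`).
* M. Dafermos, I. Rodnianski, arXiv:0910.4957, §3–§4 (key `DafermosRodnianski2010ICMP`).
-/

noncomputable section

open Bundle Set TopologicalSpace Filter MeasureTheory Metric
open scoped Manifold ContDiff Topology ENNReal

namespace Literature.Geometry.Lorentzian

namespace Kerr

/-! ### The wedge between two graphs -/

/-- The **wedge** `leafWedge F₁ F₂ s t = {x ∈ E4 | s + F₁(x⃗) < x⁰ ≤ t + F₂(x⃗)}` of the
Kerr–Schild chart between the graph `{x⁰ = s + F₁(x⃗)}` (excluded) and the graph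
`{x⁰ = t + F₂(x⃗)}` (included): for `F₁ = F₂ = h` the region swept by the leaves `Σ̃_τ(h)`,
`τ ∈ (s, t]`; for `F₁ = 0`, `F₂ = h` the region between the slice `{t* = s}` and the leaf `Σ̃_t(h)`
(DRSR arXiv:1402.7034, §2.2.5, §3.3: `𝓡(τ', τ'')`; Moschidis arXiv:1509.08489, §3.1: `𝓡(τ₁, τ₂)`).
[cite: DafermosRodnianskiShlapentokhrothman2014, §2.2.5, §3.3] -/
def leafWedge (F₁ F₂ : E3 → ℝ) (s t : ℝ) : Set E4 :=
  {x : E4 | s + F₁ (E4.spatial x) < x 0 ∧ x 0 ≤ t + F₂ (E4.spatial x)}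

/-- Membership in the wedge. [folklore] -/
theorem mem_leafWedge {F₁ F₂ : E3 → ℝ} {s t : ℝ} {x : E4} :
    x ∈ leafWedge F₁ F₂ s t ↔ s + F₁ (E4.spatial x) < x 0 ∧ x 0 ≤ t + F₂ (E4.spatial x) :=
  Iff.rfl

/-- `(t', y)` lies in the wedge iff `s + F₁ y < t' ≤ t + F₂ y`. [folklore] -/
theorem ofTimeSpace_mem_leafWedge_iff {F₁ F₂ : E3 → ℝ} {s t t' : ℝ} {y : E3} :
    E4.ofTimeSpace t' y ∈ leafWedge F₁ F₂ s t ↔ s + F₁ y < t' ∧ t' ≤ t + F₂ y := by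
  simp [mem_leafWedge]

/-- The wedge is measurable (for continuous heights). [folklore] -/
theorem measurableSet_leafWedge {F₁ F₂ : E3 → ℝ} (hF₁ : Continuous F₁) (hF₂ : Continuous F₂)
    (s t : ℝ) : MeasurableSet (leafWedge F₁ F₂ s t) := by
  have hsp : Continuous (E4.spatial : E4 → E3) := E4.spatial.continuous
  have h0 : Continuous fun x : E4 ↦ x 0 := (E4.dx 0).continuous
  exact (measurableSet_lt (continuous_const.add (hF₁.comp hsp)).measurable h0.measurable).inter
    (measurableSet_le h0.measurable (continuous_const.add (hF₂.comp hsp)).measurable)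

/-- For `F₁ = F₂ = h` the wedge is the set of points whose leaf label `x⁰ − h(x⃗)` lies in
`(s, t]` (the form of `Kerr.lintegral_lintegral_leafPoint_eq`). [folklore] -/
theorem leafWedge_self_eq (h : E3 → ℝ) (s t : ℝ) :
    leafWedge h h s t = {x : E4 | E4.spatial x ∈ (univ : Set E3) ∧ x 0 - h (E4.spatial x) ∈ Ioc s t} := by
  ext x
  simp only [mem_leafWedge, mem_setOf_eq, mem_univ, true_and, mem_Ioc]
  constructor
  · rintro ⟨h1, h2⟩; exact ⟨by linarith, by linarith⟩
  · rintro ⟨h1, h2⟩; exact ⟨by linarith, by linarith⟩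

end Kerr

namespace E4

/-- **From iterated `(t*, y)`-integrals over a wedge to a set integral on `E4`**: for a measurable
`g : E4 → [0, ∞]` and continuous heights,
`∫⁻_t ∫⁻_y 1_{s + F₁(y) < t ≤ t₁ + F₂(y)} g(t, y) = ∫⁻_{leafWedge F₁ F₂ s t₁} g`
(`E4.lintegral_eq_lintegral_time_space`). [folklore] -/
theorem lintegral_lintegral_indicator_eq_setLIntegral_leafWedge {g : E4 → ℝ≥0∞}
    (hg : Measurable g) {F₁ F₂ : E3 → ℝ} (hF₁ : Continuous F₁) (hF₂ : Continuous F₂)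
    (s t₁ : ℝ) :
    ∫⁻ t, ∫⁻ y, {p : ℝ × E3 | s + F₁ p.2 < p.1 ∧ p.1 ≤ t₁ + F₂ p.2}.indicator
        (fun p ↦ g (E4.ofTimeSpace p.1 p.2)) (t, y) =
      ∫⁻ x in Kerr.leafWedge F₁ F₂ s t₁, g x := by
  have hW := Kerr.measurableSet_leafWedge hF₁ hF₂ s t₁
  rw [← lintegral_indicator hW, lintegral_eq_lintegral_time_space _ (hg.indicator hW)]
  refine lintegral_congr fun t ↦ lintegral_congr fun y ↦ ?_
  by_cases hp : s + F₁ y < t ∧ t ≤ t₁ + F₂ y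
  · rw [indicator_of_mem (show (t, y) ∈ {p : ℝ × E3 | s + F₁ p.2 < p.1 ∧ p.1 ≤ t₁ + F₂ p.2} from hp),
      indicator_of_mem (Kerr.ofTimeSpace_mem_leafWedge_iff.2 hp)]
  · rw [indicator_of_notMem (show (t, y) ∉ {p : ℝ × E3 | s + F₁ p.2 < p.1 ∧ p.1 ≤ t₁ + F₂ p.2} from hp),
      indicator_of_notMem (fun h ↦ hp (Kerr.ofTimeSpace_mem_leafWedge_iff.1 h))]

end E4

namespace Kerr

/-! ### Support consequences of finite speed of propagation -/

/-- **A function vanishing wherever `(Φ, dΦ) = 0` has vanishing differential far out**: if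
`Φ = dΦ = 0` at the points with `x⁰ ≥ 0`, `‖x⃗‖ > ρ₀ + x⁰`, and `g = 0` wherever `(Φ, dΦ) = 0`,
then `dg(x) = 0` at every `x` with `x⁰ > 0`, `‖x⃗‖ > ρ₀ + x⁰` (the two conditions define an open
set on which `g` vanishes identically). [folklore] -/
theorem fderiv_eq_zero_of_far_support {Φ g : E4 → ℝ} {ρ₀ : ℝ}
    (hρ₀ : ∀ x : E4, 0 ≤ x 0 → ρ₀ + x 0 < E4.spatialNorm x → Φ x = 0 ∧ fderiv ℝ Φ x = 0)
    (hg : ∀ x : E4, Φ x = 0 → fderiv ℝ Φ x = 0 → g x = 0) {x : E4} (hx0 : 0 < x 0)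
    (hfar : ρ₀ + x 0 < E4.spatialNorm x) : fderiv ℝ g x = 0 := by
  have hopen : IsOpen {y : E4 | 0 < y 0 ∧ ρ₀ + y 0 < E4.spatialNorm y} := by
    have h0 : Continuous fun y : E4 ↦ y 0 := (E4.dx 0).continuous
    have hn : Continuous fun y : E4 ↦ E4.spatialNorm y := continuous_norm.comp E4.spatial.continuous
    exact (isOpen_lt continuous_const h0).inter (isOpen_lt (continuous_const.add h0) hn)
  have hev : g =ᶠ[𝓝 x] fun _ ↦ 0 := by
    filter_upwards [hopen.mem_nhds (show x ∈ {y : E4 | 0 < y 0 ∧ ρ₀ + y 0 < E4.spatialNorm y}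
      from ⟨hx0, hfar⟩)] with y hy
    obtain ⟨h1, h2⟩ := hρ₀ y hy.1.le hy.2
    exact hg y h1 h2
  rw [hev.fderiv_eq]
  simp

/-- **Support of a truncated density**: if `g = 0` wherever `(Φ, dΦ) = 0` (support radius `ρ₀`),
then for `t' ≥ 0` and any `c`, `χ(T − t') c g(t', y) ≠ 0` or `χ'(T − t') c g(t', y) ≠ 0` forces
`t' ≤ T` and `‖y‖ ≤ ρ₀ + T` (`χ = Real.smoothTransition` and its derivative vanish on `(−∞, 0]`).
[folklore] -/
theorem timeCutoff_mul_support {Φ g : E4 → ℝ} {ρ₀ : ℝ}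
    (hρ₀ : ∀ x : E4, 0 ≤ x 0 → ρ₀ + x 0 < E4.spatialNorm x → Φ x = 0 ∧ fderiv ℝ Φ x = 0)
    (hg : ∀ x : E4, Φ x = 0 → fderiv ℝ Φ x = 0 → g x = 0) (T : ℝ) {t' : ℝ} (ht' : 0 ≤ t')
    (y : E3) (c : ℝ)
    (hne : Real.smoothTransition (T - t') * (c * g (E4.ofTimeSpace t' y)) ≠ 0 ∨
      deriv Real.smoothTransition (T - t') * (c * g (E4.ofTimeSpace t' y)) ≠ 0) :
    t' ≤ T ∧ ‖y‖ ≤ ρ₀ + T := by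
  have hT : t' ≤ T := by
    by_contra hlt
    push Not at hlt
    have hz : Real.smoothTransition (T - t') = 0 := Real.smoothTransition.zero_of_nonpos (by linarith)
    have hz' : deriv Real.smoothTransition (T - t') = 0 := by
      have hev : Real.smoothTransition =ᶠ[𝓝 (T - t')] fun _ ↦ 0 := by
        filter_upwards [(isOpen_gt' (0 : ℝ)).mem_nhds (show T - t' < 0 by linarith)] with σ hσ
        exact Real.smoothTransition.zero_of_nonpos (le_of_lt hσ)
      rw [hev.deriv_eq]
      simp
    rcases hne with h | h
    · exact h (by rw [hz, zero_mul])
    · exact h (by rw [hz', zero_mul])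
  refine ⟨hT, ?_⟩
  by_contra hfar
  push Not at hfar
  have h0 : 0 ≤ (E4.ofTimeSpace t' y) 0 := by rw [E4.ofTimeSpace_apply_zero]; exact ht'
  have hfar' : ρ₀ + (E4.ofTimeSpace t' y) 0 < E4.spatialNorm (E4.ofTimeSpace t' y) := by
    rw [E4.ofTimeSpace_apply_zero, E4.spatialNorm_ofTimeSpace]; linarith
  obtain ⟨h1, h2⟩ := hρ₀ _ h0 hfar'
  have hg0 := hg _ h1 h2
  rcases hne with h | h
  · exact h (by rw [hg0, mul_zero, mul_zero])
  · exact h (by rw [hg0, mul_zero, mul_zero])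

/-- **The truncated leaf integrand vanishes far out**: if `g = 0` wherever `(Φ, dΦ) = 0`, then for
`τ ≥ 0`, a height `F ≥ 0`, a level `T` and `‖y‖ > ρ₀ + T`, `χ(T − τ − F(y)) c g(τ + F(y), y) = 0`
(either the leaf is above the level `T` over `y`, or `Φ` vanishes to first order there).
[cite: DafermosRodnianskiShlapentokhrothman2014, §4.1] -/
theorem timeCutoff_mul_leaf_eq_zero {Φ g : E4 → ℝ} {ρ₀ : ℝ}
    (hρ₀ : ∀ x : E4, 0 ≤ x 0 → ρ₀ + x 0 < E4.spatialNorm x → Φ x = 0 ∧ fderiv ℝ Φ x = 0)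
    (hg : ∀ x : E4, Φ x = 0 → fderiv ℝ Φ x = 0 → g x = 0) {F : E3 → ℝ} (hF0 : ∀ y, 0 ≤ F y)
    {τ T : ℝ} (hτ : 0 ≤ τ) {y : E3} (hy : ρ₀ + T < ‖y‖) (c : ℝ) :
    Real.smoothTransition (T - (τ + F y)) * (c * g (E4.ofTimeSpace (τ + F y) y)) = 0 := by
  rcases le_or_gt T (τ + F y) with hT | hT
  · rw [Real.smoothTransition.zero_of_nonpos (by linarith), zero_mul]
  · have h0 : 0 ≤ (E4.ofTimeSpace (τ + F y) y) 0 := by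
      rw [E4.ofTimeSpace_apply_zero]; linarith [hF0 y]
    have hfar : ρ₀ + (E4.ofTimeSpace (τ + F y) y) 0 < E4.spatialNorm (E4.ofTimeSpace (τ + F y) y) := by
      rw [E4.ofTimeSpace_apply_zero, E4.spatialNorm_ofTimeSpace]; linarith
    obtain ⟨h1, h2⟩ := hρ₀ _ h0 hfar
    rw [hg _ h1 h2, mul_zero, mul_zero]

/-! ### The engine -/

set_option maxHeartbeats 1600000 in
/-- **The far-region inequality for a general cut-off current between a lower graph and a leaf of
subextremal Kerr, with a smeared time cut-off** (see the module docstring). Data: `|a| < M`,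
`R₁ > 2M`, `R' > R_af`; a function `Φ` on `ℝ⁴` with `Φ = dΦ = 0` at the points `x⁰ ≥ 0`,
`‖x⃗‖ > ρ₀ + x⁰` (the extension by zero `ψ̃` of an admissible wave, by finite speed of propagation,
`IsAdmissibleKerrWave.exists_extend_eq_zero_of_lt`); a current `J` on `ℝ⁴`, `C¹` at the points of
the far region `{‖x⃗‖ > R_af}` and vanishing wherever `(Φ, dΦ) = 0`; densities
`D_g, D_b, P_g, P_b, E_g, E_b, E_bot : E4 → ℝ`, continuous at the far points, vanishing wherever
`(Φ, dΦ) = 0`, non-negative at the points with `‖x⃗‖ ≥ R'`, and a continuous non-negative collar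
majorant `Coll` vanishing wherever `(Φ, dΦ) = 0`; the pointwise bounds at the points with
`‖x⃗‖ ≥ R'`: `D_g − D_b ≤ ∑_μ ∂_μ J^μ`, `P_g − P_b ≤ −J⁰`, `E_g − E_b ≤ −∑_μ J^μ n^{h♯}_μ`,
`−∑_μ J^μ n^{F₁}_μ ≤ E_bot`, and everywhere `|∑_μ J^μ ∂_μ f| ≤ Coll` (`f(x) = u_{R',R'}(x⃗)`); a `C²`
lower height `0 ≤ F₁ ≤ h♯_{R₁}`; `0 ≤ s ≤ t` and a level `T`. Conclusion: with
`χ = Real.smoothTransition`, `W = leafWedge F₁ h♯_{R₁} s t`,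
`∫ χ(T−t−h♯(y)) f E_g(t + h♯(y), y) dy + ∫_W χ(T−x⁰) f D_g + ∫_W χ'(T−x⁰) f P_g
  ≤ ∫ χ(T−s−F₁(y)) f E_bot(s + F₁(y), y) dy + ∫ χ(T−t−h♯(y)) f E_b(t + h♯(y), y) dy
    + ∫_W χ(T−x⁰) f D_b + ∫_W χ'(T−x⁰) f P_b + ∫_W χ(T−x⁰) Coll`.
Proof: the divergence identity `E4.graphFlux_sub_eq_integral_integral_timeCutoff` for the global
`C¹` current `f J` (`E4.contDiff_mul_of_tsupport_subset`; its divergence is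
`f ∑∂_μJ^μ + ∑ J^μ ∂_μ f`, `E4.fderiv_mul_of_tsupport_subset`; it vanishes on the far part of the
wedge below the level `T`), the pointwise bounds (off `tsupport f` every term vanishes),
monotonicity and additivity of the wedge integrals (`E4.integral_integral_Ioc_mono`,
`E4.integrable_indicator_wedge`), and the conversion of non-negative integrals to Lebesgue
integrals (`E4.ofReal_integral_integral_Ioc_eq_lintegral`,
`E4.lintegral_lintegral_indicator_eq_setLIntegral_leafWedge`). DRSR arXiv:1402.7034, §2.3.2 with
Remark 2.3.1; Moschidis arXiv:1509.08489, proofs of Lemmas 4.1, 4.5 and Thm. 5.1.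
[cite: DafermosRodnianskiShlapentokhrothman2014, §2.3.2 and Remark 2.3.1; Moschidis2016 Thm. 5.1 (proof)] -/
theorem far_current_inequality {M a R₁ R' : ℝ} (hMa : IsSubextremal M a) (hR₁ : 2 * M < R₁)
    (hR'af : afRadius a (rPlus M a) < R') {Φ : E4 → ℝ} {ρ₀ : ℝ}
    (hρ₀ : ∀ x : E4, 0 ≤ x 0 → ρ₀ + x 0 < E4.spatialNorm x → Φ x = 0 ∧ fderiv ℝ Φ x = 0)
    {J : E4 → Fin 4 → ℝ}
    (hJ : ∀ x : E4, afRadius a (rPlus M a) < E4.spatialNorm x → ∀ μ, ContDiffAt ℝ 1 (fun y ↦ J y μ) x)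
    (hJ0 : ∀ x : E4, Φ x = 0 → fderiv ℝ Φ x = 0 → ∀ μ, J x μ = 0)
    {Dg Db Pg Pb Eg Eb Ebot Coll : E4 → ℝ}
    (hDgc : ∀ x : E4, afRadius a (rPlus M a) < E4.spatialNorm x → ContinuousAt Dg x)
    (hDbc : ∀ x : E4, afRadius a (rPlus M a) < E4.spatialNorm x → ContinuousAt Db x)
    (hPgc : ∀ x : E4, afRadius a (rPlus M a) < E4.spatialNorm x → ContinuousAt Pg x)
    (hPbc : ∀ x : E4, afRadius a (rPlus M a) < E4.spatialNorm x → ContinuousAt Pb x)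
    (hEgc : ∀ x : E4, afRadius a (rPlus M a) < E4.spatialNorm x → ContinuousAt Eg x)
    (hEbc : ∀ x : E4, afRadius a (rPlus M a) < E4.spatialNorm x → ContinuousAt Eb x)
    (hEbotc : ∀ x : E4, afRadius a (rPlus M a) < E4.spatialNorm x → ContinuousAt Ebot x)
    (hCollc : Continuous Coll)
    (hDg0 : ∀ x : E4, Φ x = 0 → fderiv ℝ Φ x = 0 → Dg x = 0)
    (hDb0 : ∀ x : E4, Φ x = 0 → fderiv ℝ Φ x = 0 → Db x = 0)
    (hPg0 : ∀ x : E4, Φ x = 0 → fderiv ℝ Φ x = 0 → Pg x = 0)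
    (hPb0 : ∀ x : E4, Φ x = 0 → fderiv ℝ Φ x = 0 → Pb x = 0)
    (hEg0 : ∀ x : E4, Φ x = 0 → fderiv ℝ Φ x = 0 → Eg x = 0)
    (hEb0 : ∀ x : E4, Φ x = 0 → fderiv ℝ Φ x = 0 → Eb x = 0)
    (hEbot0 : ∀ x : E4, Φ x = 0 → fderiv ℝ Φ x = 0 → Ebot x = 0)
    (hColl0 : ∀ x : E4, Φ x = 0 → fderiv ℝ Φ x = 0 → Coll x = 0)
    (hDgnn : ∀ x : E4, R' ≤ E4.spatialNorm x → 0 ≤ Dg x)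
    (hDbnn : ∀ x : E4, R' ≤ E4.spatialNorm x → 0 ≤ Db x)
    (hPgnn : ∀ x : E4, R' ≤ E4.spatialNorm x → 0 ≤ Pg x)
    (hPbnn : ∀ x : E4, R' ≤ E4.spatialNorm x → 0 ≤ Pb x)
    (hEgnn : ∀ x : E4, R' ≤ E4.spatialNorm x → 0 ≤ Eg x)
    (hEbnn : ∀ x : E4, R' ≤ E4.spatialNorm x → 0 ≤ Eb x)
    (hEbotnn : ∀ x : E4, R' ≤ E4.spatialNorm x → 0 ≤ Ebot x)
    (hCollnn : ∀ x : E4, 0 ≤ Coll x)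
    (hdiv : ∀ x : E4, R' ≤ E4.spatialNorm x →
      Dg x - Db x ≤ ∑ μ, fderiv ℝ (fun y ↦ J y μ) x (E4.basisVector μ))
    (hplate : ∀ x : E4, R' ≤ E4.spatialNorm x → Pg x - Pb x ≤ -J x 0)
    (htop : ∀ x : E4, R' ≤ E4.spatialNorm x →
      Eg x - Eb x ≤ -∑ μ, J x μ * graphConormal (scriHeight M a R₁) (E4.spatial x) μ)
    {F₁ : E3 → ℝ} (hF₁ : ContDiff ℝ 2 F₁) (hF₁0 : ∀ y, 0 ≤ F₁ y)
    (hF₁h : ∀ y, F₁ y ≤ scriHeight M a R₁ y)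
    (hbot : ∀ x : E4, R' ≤ E4.spatialNorm x →
      -∑ μ, J x μ * graphConormal F₁ (E4.spatial x) μ ≤ Ebot x)
    (hcoll : ∀ x : E4, |∑ μ, J x μ *
      fderiv ℝ (fun z : E4 ↦ radialTransition R' R' (E4.spatial z)) x (E4.basisVector μ)| ≤ Coll x)
    {s t : ℝ} (hs : 0 ≤ s) (hst : s ≤ t) (T : ℝ) :
    (∫⁻ y, ENNReal.ofReal (Real.smoothTransition (T - (t + scriHeight M a R₁ y)) *
        (radialTransition R' R' y * Eg (E4.ofTimeSpace (t + scriHeight M a R₁ y) y)))) +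
      (∫⁻ x in leafWedge F₁ (scriHeight M a R₁) s t, ENNReal.ofReal (Real.smoothTransition (T - x 0) *
        (radialTransition R' R' (E4.spatial x) * Dg x))) +
      (∫⁻ x in leafWedge F₁ (scriHeight M a R₁) s t, ENNReal.ofReal (deriv Real.smoothTransition (T - x 0) *
        (radialTransition R' R' (E4.spatial x) * Pg x))) ≤
    (∫⁻ y, ENNReal.ofReal (Real.smoothTransition (T - (s + F₁ y)) *
        (radialTransition R' R' y * Ebot (E4.ofTimeSpace (s + F₁ y) y)))) +
      (∫⁻ y, ENNReal.ofReal (Real.smoothTransition (T - (t + scriHeight M a R₁ y)) *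
        (radialTransition R' R' y * Eb (E4.ofTimeSpace (t + scriHeight M a R₁ y) y)))) +
      (∫⁻ x in leafWedge F₁ (scriHeight M a R₁) s t, ENNReal.ofReal (Real.smoothTransition (T - x 0) *
        (radialTransition R' R' (E4.spatial x) * Db x))) +
      (∫⁻ x in leafWedge F₁ (scriHeight M a R₁) s t, ENNReal.ofReal (deriv Real.smoothTransition (T - x 0) *
        (radialTransition R' R' (E4.spatial x) * Pb x))) +
      (∫⁻ x in leafWedge F₁ (scriHeight M a R₁) s t, ENNReal.ofReal (Real.smoothTransition (T - x 0) *
        Coll x)) := by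
  have hM : 0 < M := hMa.pos
  have hR' : 0 < R' := (afRadius_pos a (rPlus M a)).trans hR'af
  have hRp : rPlus M a < R₁ := (rPlus_le_two_mul hM.le).trans_lt hR₁
  -- notation
  set f : E4 → ℝ := fun x ↦ radialTransition R' R' (E4.spatial x) with hf
  set U : Set E4 := {x | afRadius a (rPlus M a) < E4.spatialNorm x} with hU
  set h : E3 → ℝ := scriHeight M a R₁ with hh
  set χ : ℝ → ℝ := Real.smoothTransition with hχ
  have hF : ContDiff ℝ 2 h := hMa.contDiff_scriHeight hRp
  have hh0 : ∀ y, 0 ≤ h y := fun y ↦ scriHeight_nonneg hMa hRp y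
  have hhc : Continuous h := hF.continuous
  have hF₁c : Continuous F₁ := hF₁.continuous
  have hF1 : ContDiff ℝ 1 h := hF.of_le one_le_two
  have hF₁1 : ContDiff ℝ 1 F₁ := hF₁.of_le one_le_two
  have hfU : tsupport f ⊆ U := fun x hx ↦
    hR'af.trans_le (tsupport_radialTransition_comp_spatial_subset hR' hx)
  have hf1 : ContDiff ℝ 1 f := contDiff_radialTransition_comp_spatial hR'
  have hfc : Continuous f := hf1.continuous
  have hf0 : ∀ x, 0 ≤ f x := fun x ↦ radialTransition_nonneg _ _ _
  have hfval : ∀ (τ : ℝ) (y : E3), f (E4.ofTimeSpace τ y) = radialTransition R' R' y := by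
    intro τ y; simp [hf]
  have hχ0 : ∀ σ, 0 ≤ χ σ := fun σ ↦ Real.smoothTransition.nonneg σ
  have hχ'0 : ∀ σ, 0 ≤ deriv χ σ := fun σ ↦ Real.smoothTransition.monotone.deriv_nonneg
  have hχc : Continuous χ := Real.smoothTransition.continuous
  have hχ'c : Continuous (deriv χ) := Real.smoothTransition.contDiff.continuous_deriv le_rfl
  -- far points: on `tsupport f` the norm is `≥ R'`; off it `f = ∂f = 0`
  have hfar_of_ne : ∀ x : E4, f x ≠ 0 → R' ≤ E4.spatialNorm x := by
    intro x hx
    by_contra hlt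
    exact hx (radialTransition_of_norm_le hR' (le_of_lt (not_le.1 hlt)))
  have hdf0 : ∀ x : E4, x ∉ tsupport f → ∀ μ, fderiv ℝ f x (E4.basisVector μ) = 0 := fun x hx μ ↦ by
    rw [fderiv_of_notMem_tsupport ℝ hx]; rfl
  -- ### Step 1: the identity for the global `C¹` current `f J`
  have hJU : ∀ x ∈ U, ∀ μ, ContDiffAt ℝ 1 (fun y ↦ J y μ) x := fun x hx μ ↦ hJ x hx μ
  have hJ1 : ∀ μ, ContDiff ℝ 1 fun x ↦ f x * J x μ := fun μ ↦
    E4.contDiff_mul_of_tsupport_subset hfU hf1 fun x hx ↦ hJU x hx μ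
  have hF₂ : ContDiff ℝ 2 fun y ↦ (t - s) + h y := contDiff_const.add hF
  have hle : ∀ y, F₁ y ≤ (t - s) + h y := fun y ↦ by linarith [hF₁h y, sub_nonneg.2 hst]
  have hJfar : ∀ μ (x : E4), ρ₀ + T < E4.spatialNorm x → s + F₁ (E4.spatial x) ≤ x 0 →
      x 0 ≤ s + ((t - s) + h (E4.spatial x)) → x 0 < T → f x * J x μ = 0 := by
    intro μ x hxρ hx1 _ hxT
    have hx0 : 0 ≤ x 0 := by linarith [hF₁0 (E4.spatial x)]
    obtain ⟨h1, h2⟩ := hρ₀ x hx0 (by linarith)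
    rw [hJ0 x h1 h2 μ, mul_zero]
  have hid := E4.graphFlux_sub_eq_integral_integral_timeCutoff (J := fun μ x ↦ f x * J x μ) hJ1
    Real.smoothTransition.contDiff (fun σ hσ ↦ Real.smoothTransition.zero_of_nonpos hσ) hF₁ hF₂ hle
    (τ := s) (T := T) (ρ := ρ₀ + T) hJfar
  simp only [show ∀ y, s + (t - s + h y) = t + h y from fun y ↦ by ring] at hid
  have hn : ∀ (y : E3) (μ : Fin 4), graphConormal (fun y ↦ t - s + h y) y μ = graphConormal h y μ := by
    intro y μ
    refine Fin.cases rfl (fun i ↦ ?_) μ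
    simp only [graphConormal_succ, partialE3, fderiv_const_add]
  simp only [hn] at hid
  -- the divergence of `f J`
  have hdivfJ : ∀ x : E4, ∑ μ, fderiv ℝ (fun y ↦ f y * J y μ) x (E4.basisVector μ) =
      f x * ∑ μ, fderiv ℝ (fun y ↦ J y μ) x (E4.basisVector μ) +
        ∑ μ, J x μ * fderiv ℝ f x (E4.basisVector μ) := by
    intro x
    have hprod : ∀ μ, fderiv ℝ (fun y ↦ f y * J y μ) x (E4.basisVector μ) =
        f x * fderiv ℝ (fun y ↦ J y μ) x (E4.basisVector μ) + J x μ * fderiv ℝ f x (E4.basisVector μ) :=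
      fun μ ↦ E4.fderiv_mul_of_tsupport_subset hfU hf1
        (fun z hz ↦ (hJU z hz μ).differentiableAt one_ne_zero) _ _
    simp only [hprod, Finset.sum_add_distrib, ← Finset.mul_sum]
  -- ### Step 2: the integrands and their pointwise comparison
  -- the identity's space-time integrand
  set D : ℝ → E3 → ℝ := fun t' y ↦
    χ (T - t') * ∑ μ, fderiv ℝ (fun x ↦ f x * J x μ) (E4.ofTimeSpace t' y) (E4.basisVector μ) -
      deriv χ (T - t') * (f (E4.ofTimeSpace t' y) * J (E4.ofTimeSpace t' y) 0) with hD
  -- good and bad parts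
  set G₁ : ℝ → E3 → ℝ := fun t' y ↦
    χ (T - t') * (f (E4.ofTimeSpace t' y) * Dg (E4.ofTimeSpace t' y)) +
      deriv χ (T - t') * (f (E4.ofTimeSpace t' y) * Pg (E4.ofTimeSpace t' y)) with hG₁
  set G₂ : ℝ → E3 → ℝ := fun t' y ↦
    χ (T - t') * (f (E4.ofTimeSpace t' y) * Db (E4.ofTimeSpace t' y)) +
      deriv χ (T - t') * (f (E4.ofTimeSpace t' y) * Pb (E4.ofTimeSpace t' y)) +
      χ (T - t') * Coll (E4.ofTimeSpace t' y) with hG₂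
  -- pointwise: `G₁ − G₂ ≤ D` everywhere
  have hptD : ∀ t' y, G₁ t' y - G₂ t' y ≤ D t' y := by
    intro t' y
    simp only [hD, hG₁, hG₂, hdivfJ]
    set x := E4.ofTimeSpace t' y with hx
    have hζ := hχ0 (T - t')
    have hζ' := hχ'0 (T - t')
    have hC := hCollnn x
    have hcx := hcoll x
    have hcx' : -Coll x ≤ ∑ μ, J x μ * fderiv ℝ f x (E4.basisVector μ) := (abs_le.1 hcx).1
    by_cases hfx : f x = 0
    · -- off the far region: `f = 0`
      simp only [hfx, zero_mul, mul_zero, zero_add, zero_sub, add_zero]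
      have : -(χ (T - t') * Coll x) ≤ χ (T - t') * ∑ μ, J x μ * fderiv ℝ f x (E4.basisVector μ) := by
        have := mul_le_mul_of_nonneg_left hcx' hζ; linarith
      linarith
    · have hxR : R' ≤ E4.spatialNorm x := hfar_of_ne x hfx
      have hfx0 : 0 ≤ f x := hf0 x
      have h1 := mul_le_mul_of_nonneg_left (hdiv x hxR) hfx0
      have h2 := mul_le_mul_of_nonneg_left (hplate x hxR) hfx0
      have h1' := mul_le_mul_of_nonneg_left
        (show f x * (Dg x - Db x) - Coll x ≤ f x * ∑ μ, fderiv ℝ (fun y ↦ J y μ) x (E4.basisVector μ) +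
          ∑ μ, J x μ * fderiv ℝ f x (E4.basisVector μ) by linarith) hζ
      have h2' := mul_le_mul_of_nonneg_left h2 hζ'
      nlinarith [h1', h2']
  -- continuity of the integrands
  have hcont_fd : ∀ {d : E4 → ℝ}, (∀ x : E4, afRadius a (rPlus M a) < E4.spatialNorm x → ContinuousAt d x) →
      Continuous fun x ↦ f x * d x := fun hd ↦
    continuous_mul_of_tsupport_subset hfU hfc fun x hx ↦ hd x hx
  have hζxc : Continuous fun x : E4 ↦ χ (T - x 0) := hχc.comp (continuous_const.sub (E4.dx 0).continuous)
  have hζ'xc : Continuous fun x : E4 ↦ deriv χ (T - x 0) :=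
    hχ'c.comp (continuous_const.sub (E4.dx 0).continuous)
  have hG₁xc : Continuous fun x : E4 ↦ χ (T - x 0) * (f x * Dg x) + deriv χ (T - x 0) * (f x * Pg x) :=
    (hζxc.mul (hcont_fd hDgc)).add (hζ'xc.mul (hcont_fd hPgc))
  have hG₂xc : Continuous fun x : E4 ↦ χ (T - x 0) * (f x * Db x) + deriv χ (T - x 0) * (f x * Pb x) +
      χ (T - x 0) * Coll x :=
    ((hζxc.mul (hcont_fd hDbc)).add (hζ'xc.mul (hcont_fd hPbc))).add (hζxc.mul hCollc)
  have hdivc : Continuous fun x : E4 ↦ f x * ∑ μ, fderiv ℝ (fun y ↦ J y μ) x (E4.basisVector μ) := by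
    refine continuous_mul_of_tsupport_subset hfU hfc fun x hx ↦ ?_
    refine (continuous_finsetSum _ fun μ _ ↦ continuous_apply μ).continuousAt.comp
      (continuousAt_pi.2 fun μ ↦ ?_) |>.congr (Eventually.of_forall fun _ ↦ rfl)
    exact ((hJU x hx μ).fderiv_right (m := 0) le_rfl).continuousAt.clm_apply continuousAt_const
  have hJdfc : Continuous fun x : E4 ↦ ∑ μ, J x μ * fderiv ℝ f x (E4.basisVector μ) := by
    refine continuous_finsetSum _ fun μ _ ↦ ?_
    have : Continuous fun x : E4 ↦ fderiv ℝ f x (E4.basisVector μ) * J x μ :=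
      continuous_mul_of_tsupport_subset ((tsupport_fderiv_apply_subset ℝ (E4.basisVector μ)).trans hfU)
        ((hf1.continuous_fderiv one_ne_zero).clm_apply continuous_const)
        fun x hx ↦ (hJU x hx μ).continuousAt
    simpa only [mul_comm] using this
  have hfJ0c : Continuous fun x : E4 ↦ f x * J x 0 :=
    continuous_mul_of_tsupport_subset hfU hfc fun x hx ↦ (hJU x hx 0).continuousAt
  have hDxc : Continuous fun x : E4 ↦ χ (T - x 0) * (f x * ∑ μ, fderiv ℝ (fun y ↦ J y μ) x (E4.basisVector μ) +
      ∑ μ, J x μ * fderiv ℝ f x (E4.basisVector μ)) - deriv χ (T - x 0) * (f x * J x 0) :=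
    (hζxc.mul (hdivc.add hJdfc)).sub (hζ'xc.mul hfJ0c)
  have hDc : Continuous (Function.uncurry D) := by
    have := hDxc.comp E4.continuous_ofTimeSpace_uncurry
    refine this.congr fun p ↦ ?_
    simp only [hD, Function.uncurry, Function.comp_apply, E4.ofTimeSpace_apply_zero, hdivfJ]
  have hG₁c : Continuous (Function.uncurry G₁) := by
    have := hG₁xc.comp E4.continuous_ofTimeSpace_uncurry
    refine this.congr fun p ↦ ?_
    simp only [hG₁, Function.uncurry, Function.comp_apply, E4.ofTimeSpace_apply_zero]
  have hG₂c : Continuous (Function.uncurry G₂) := by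
    have := hG₂xc.comp E4.continuous_ofTimeSpace_uncurry
    refine this.congr fun p ↦ ?_
    simp only [hG₂, Function.uncurry, Function.comp_apply, E4.ofTimeSpace_apply_zero]
  have hG₁₂c : Continuous (Function.uncurry fun t' y ↦ G₁ t' y - G₂ t' y) := hG₁c.sub hG₂c
  -- supports (finite speed of propagation below the level `T`)
  have ha : Continuous fun y ↦ s + F₁ y := continuous_const.add hF₁c
  have hb : Continuous fun y ↦ t + h y := continuous_const.add hhc
  have ht'0 : ∀ {t' : ℝ} {y : E3}, s + F₁ y < t' → 0 < t' := fun {t' y} h1 ↦ by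
    linarith [hF₁0 y]
  -- vanishing of `J`, `∂J`, `∂(fJ)` far out
  have hJzero : ∀ {x : E4}, 0 ≤ x 0 → ρ₀ + x 0 < E4.spatialNorm x → ∀ μ, J x μ = 0 := by
    intro x hx0 hxρ μ
    obtain ⟨h1, h2⟩ := hρ₀ x hx0 hxρ
    exact hJ0 x h1 h2 μ
  have hdJzero : ∀ {x : E4}, 0 < x 0 → ρ₀ + x 0 < E4.spatialNorm x → ∀ μ,
      fderiv ℝ (fun y ↦ J y μ) x = 0 := fun {x} hx0 hxρ μ ↦
    fderiv_eq_zero_of_far_support hρ₀ (fun z h1 h2 ↦ hJ0 z h1 h2 μ) hx0 hxρ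
  have hsupp_of : ∀ {g : E4 → ℝ}, (∀ x : E4, Φ x = 0 → fderiv ℝ Φ x = 0 → g x = 0) →
      ∀ (c : ℝ → E3 → ℝ) (t' : ℝ) (y : E3), s + F₁ y < t' →
        (χ (T - t') * (c t' y * g (E4.ofTimeSpace t' y)) ≠ 0 ∨
          deriv χ (T - t') * (c t' y * g (E4.ofTimeSpace t' y)) ≠ 0) →
        t' ∈ Icc 0 T ∧ ‖y‖ ≤ ρ₀ + T := by
    intro g hg c t' y h1 hne
    have h0 : 0 ≤ t' := (ht'0 h1).le
    obtain ⟨hT, hy⟩ := timeCutoff_mul_support hρ₀ hg T h0 y (c t' y) hne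
    exact ⟨⟨h0, hT⟩, hy⟩
  have hsuppG₁ : ∀ t' y, s + F₁ y < t' → t' ≤ t + h y → G₁ t' y ≠ 0 →
      t' ∈ Icc 0 T ∧ ‖y‖ ≤ ρ₀ + T := by
    intro t' y h1 _ hne
    by_contra hcon
    apply hne
    have k1 : χ (T - t') * (f (E4.ofTimeSpace t' y) * Dg (E4.ofTimeSpace t' y)) = 0 := by
      by_contra hk; exact hcon (hsupp_of hDg0 (fun t' y ↦ f (E4.ofTimeSpace t' y)) t' y h1 (Or.inl hk))
    have k2 : deriv χ (T - t') * (f (E4.ofTimeSpace t' y) * Pg (E4.ofTimeSpace t' y)) = 0 := by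
      by_contra hk; exact hcon (hsupp_of hPg0 (fun t' y ↦ f (E4.ofTimeSpace t' y)) t' y h1 (Or.inr hk))
    simp only [hG₁, k1, k2, add_zero]
  have hsuppG₂ : ∀ t' y, s + F₁ y < t' → t' ≤ t + h y → G₂ t' y ≠ 0 →
      t' ∈ Icc 0 T ∧ ‖y‖ ≤ ρ₀ + T := by
    intro t' y h1 _ hne
    by_contra hcon
    apply hne
    have k1 : χ (T - t') * (f (E4.ofTimeSpace t' y) * Db (E4.ofTimeSpace t' y)) = 0 := by
      by_contra hk; exact hcon (hsupp_of hDb0 (fun t' y ↦ f (E4.ofTimeSpace t' y)) t' y h1 (Or.inl hk))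
    have k2 : deriv χ (T - t') * (f (E4.ofTimeSpace t' y) * Pb (E4.ofTimeSpace t' y)) = 0 := by
      by_contra hk; exact hcon (hsupp_of hPb0 (fun t' y ↦ f (E4.ofTimeSpace t' y)) t' y h1 (Or.inr hk))
    have k3 : χ (T - t') * Coll (E4.ofTimeSpace t' y) = 0 := by
      by_contra hk
      refine hcon (hsupp_of hColl0 (fun _ _ ↦ 1) t' y h1 (Or.inl ?_))
      simpa using hk
    simp only [hG₂, k1, k2, k3, add_zero]
  have hsuppG₁₂ : ∀ t' y, s + F₁ y < t' → t' ≤ t + h y → (fun t' y ↦ G₁ t' y - G₂ t' y) t' y ≠ 0 →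
      t' ∈ Icc 0 T ∧ ‖y‖ ≤ ρ₀ + T := by
    intro t' y h1 h2 hne
    by_cases k1 : G₁ t' y = 0
    · have k2 : G₂ t' y ≠ 0 := fun k2 ↦ hne (by simp [k1, k2])
      exact hsuppG₂ t' y h1 h2 k2
    · exact hsuppG₁ t' y h1 h2 k1
  have hsuppD : ∀ t' y, s + F₁ y < t' → t' ≤ t + h y → D t' y ≠ 0 →
      t' ∈ Icc 0 T ∧ ‖y‖ ≤ ρ₀ + T := by
    intro t' y h1 _ hne
    have h0 : 0 < t' := ht'0 h1
    -- above the level both cut-offs vanish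
    have hT : t' ≤ T := by
      by_contra hlt
      push Not at hlt
      have hz : χ (T - t') = 0 := Real.smoothTransition.zero_of_nonpos (by linarith)
      have hz' : deriv χ (T - t') = 0 := by
        have hev : Real.smoothTransition =ᶠ[𝓝 (T - t')] fun _ ↦ 0 := by
          filter_upwards [(isOpen_gt' (0 : ℝ)).mem_nhds (show T - t' < 0 by linarith)] with σ hσ
          exact Real.smoothTransition.zero_of_nonpos (le_of_lt hσ)
        rw [hχ, hev.deriv_eq]; simp
      exact hne (by simp only [hD, hz, hz', zero_mul, sub_zero])
    refine ⟨⟨h0.le, hT⟩, ?_⟩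
    by_contra hyfar
    push Not at hyfar
    have hxρ : ρ₀ + (E4.ofTimeSpace t' y) 0 < E4.spatialNorm (E4.ofTimeSpace t' y) := by
      rw [E4.ofTimeSpace_apply_zero, E4.spatialNorm_ofTimeSpace]; linarith
    have hx0 : 0 < (E4.ofTimeSpace t' y) 0 := by rw [E4.ofTimeSpace_apply_zero]; exact h0
    have hJz := hJzero hx0.le hxρ
    have hdJz := hdJzero hx0 hxρ
    apply hne
    simp only [hD, hdivfJ, hJz, hdJz, zero_mul, mul_zero, Finset.sum_const_zero, add_zero, sub_zero,
      zero_apply]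
  -- ### Step 3: the inequality between the space-time integrals
  have hint : ∫ y, ∫ t' in Ioc (s + F₁ y) (t + h y), (fun t' y ↦ G₁ t' y - G₂ t' y) t' y ≤
      ∫ y, ∫ t' in Ioc (s + F₁ y) (t + h y), D t' y :=
    E4.integral_integral_Ioc_mono hG₁₂c hDc ha hb hsuppG₁₂ hsuppD fun t' y _ _ ↦ hptD t' y
  have hsplit : ∫ y, ∫ t' in Ioc (s + F₁ y) (t + h y), (fun t' y ↦ G₁ t' y - G₂ t' y) t' y =
      (∫ y, ∫ t' in Ioc (s + F₁ y) (t + h y), G₁ t' y) -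
        ∫ y, ∫ t' in Ioc (s + F₁ y) (t + h y), G₂ t' y := by
    rw [E4.integral_integral_Ioc_eq_integral_indicator hG₁₂c ha hb hsuppG₁₂,
      E4.integral_integral_Ioc_eq_integral_indicator hG₁c ha hb hsuppG₁,
      E4.integral_integral_Ioc_eq_integral_indicator hG₂c ha hb hsuppG₂,
      ← integral_sub (E4.integrable_indicator_wedge hG₁c ha hb hsuppG₁)
        (E4.integrable_indicator_wedge hG₂c ha hb hsuppG₂)]
    refine integral_congr_ae (Eventually.of_forall fun p ↦ ?_)
    by_cases hp : p ∈ {p : ℝ × E3 | s + F₁ p.2 < p.1 ∧ p.1 ≤ t + h p.2}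
    · simp only [indicator_of_mem hp, Function.uncurry]
    · simp only [indicator_of_notMem hp, sub_zero]
  -- ### Step 4: the leaf integrals
  -- top: `χ f (E_g − E_b) ≤ −χ ∑ (fJ)·n^h`; bottom: `−χ ∑ (fJ)·n^{F₁} ≤ χ f E_bot`
  set topJ : E3 → ℝ := fun y ↦ χ (T - (t + h y)) *
    ∑ μ, f (E4.ofTimeSpace (t + h y) y) * J (E4.ofTimeSpace (t + h y) y) μ * graphConormal h y μ with htopJ
  set botJ : E3 → ℝ := fun y ↦ χ (T - (s + F₁ y)) *
    ∑ μ, f (E4.ofTimeSpace (s + F₁ y) y) * J (E4.ofTimeSpace (s + F₁ y) y) μ * graphConormal F₁ y μ with hbotJ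
  set topG : E3 → ℝ := fun y ↦ χ (T - (t + h y)) * (f (E4.ofTimeSpace (t + h y) y) * Eg (E4.ofTimeSpace (t + h y) y))
    with htopG
  set topB : E3 → ℝ := fun y ↦ χ (T - (t + h y)) * (f (E4.ofTimeSpace (t + h y) y) * Eb (E4.ofTimeSpace (t + h y) y))
    with htopB
  set botE : E3 → ℝ := fun y ↦ χ (T - (s + F₁ y)) * (f (E4.ofTimeSpace (s + F₁ y) y) * Ebot (E4.ofTimeSpace (s + F₁ y) y))
    with hbotE
  have hidE : (∫ y, topJ y) - ∫ y, botJ y = ∫ y, ∫ t' in Ioc (s + F₁ y) (t + h y), D t' y := by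
    simpa only [htopJ, hbotJ, hD] using hid
  -- pointwise bounds on the leaves
  have hsumf : ∀ (x : E4) (n : Fin 4 → ℝ), ∑ μ, f x * J x μ * n μ = f x * ∑ μ, J x μ * n μ := by
    intro x n; rw [Finset.mul_sum]; exact Finset.sum_congr rfl fun μ _ ↦ by ring
  have htop_pt : ∀ y, topG y - topB y ≤ -topJ y := by
    intro y
    simp only [htopG, htopB, htopJ, hsumf]
    set x := E4.ofTimeSpace (t + h y) y with hx
    have hsp : E4.spatial x = y := by simp [hx]
    have hζ := hχ0 (T - (t + h y))
    by_cases hfx : f x = 0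
    · rw [hfx]; simp
    · have hxR : R' ≤ E4.spatialNorm x := hfar_of_ne x hfx
      have key := mul_le_mul_of_nonneg_left (htop x hxR) (hf0 x)
      rw [hsp] at key
      have := mul_le_mul_of_nonneg_left key hζ
      nlinarith [this]
  have hbot_pt : ∀ y, -botJ y ≤ botE y := by
    intro y
    simp only [hbotE, hbotJ, hsumf]
    set x := E4.ofTimeSpace (s + F₁ y) y with hx
    have hsp : E4.spatial x = y := by simp [hx]
    have hζ := hχ0 (T - (s + F₁ y))
    by_cases hfx : f x = 0
    · rw [hfx]; simp
    · have hxR : R' ≤ E4.spatialNorm x := hfar_of_ne x hfx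
      have key := mul_le_mul_of_nonneg_left (hbot x hxR) (hf0 x)
      rw [hsp] at key
      have := mul_le_mul_of_nonneg_left key hζ
      nlinarith [this]
  -- continuity, sign and compact support of the leaf integrands
  have hleafc : ∀ {d : E4 → ℝ}, (∀ x : E4, afRadius a (rPlus M a) < E4.spatialNorm x → ContinuousAt d x) →
      ∀ {F : E3 → ℝ}, Continuous F → ∀ τ : ℝ,
        Continuous fun y ↦ χ (T - (τ + F y)) * (f (E4.ofTimeSpace (τ + F y) y) * d (E4.ofTimeSpace (τ + F y) y)) := by
    intro d hd F hFc τ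
    exact (hχc.comp (continuous_const.sub (continuous_const.add hFc))).mul
      ((hcont_fd hd).comp (E4.continuous_ofTimeSpace' (continuous_const.add hFc) continuous_id))
  have hleafsupp : ∀ {d : E4 → ℝ}, (∀ x : E4, Φ x = 0 → fderiv ℝ Φ x = 0 → d x = 0) →
      ∀ {F : E3 → ℝ}, (∀ y, 0 ≤ F y) → ∀ {τ : ℝ}, 0 ≤ τ →
        HasCompactSupport fun y ↦ χ (T - (τ + F y)) * (f (E4.ofTimeSpace (τ + F y) y) * d (E4.ofTimeSpace (τ + F y) y)) := by
    intro d hd F hF0 τ hτ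
    refine HasCompactSupport.intro (isCompact_closedBall (0 : E3) (ρ₀ + T)) fun y hy ↦ ?_
    rw [mem_closedBall, dist_zero_right, not_le] at hy
    exact timeCutoff_mul_leaf_eq_zero hρ₀ hd hF0 hτ hy _
  have hleafnn : ∀ {d : E4 → ℝ}, (∀ x : E4, R' ≤ E4.spatialNorm x → 0 ≤ d x) →
      ∀ (F : E3 → ℝ) (τ : ℝ) (y : E3),
        0 ≤ χ (T - (τ + F y)) * (f (E4.ofTimeSpace (τ + F y) y) * d (E4.ofTimeSpace (τ + F y) y)) := by
    intro d hd F τ y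
    refine mul_nonneg (hχ0 _) ?_
    by_cases hfx : f (E4.ofTimeSpace (τ + F y) y) = 0
    · rw [hfx, zero_mul]
    · exact mul_nonneg (hf0 _) (hd _ (hfar_of_ne _ hfx))
  have ht0 : 0 ≤ t := hs.trans hst
  have htopGc : Continuous topG := hleafc hEgc hhc t
  have htopBc : Continuous topB := hleafc hEbc hhc t
  have hbotEc : Continuous botE := hleafc hEbotc hF₁c s
  have htopGi : Integrable topG := htopGc.integrable_of_hasCompactSupport (hleafsupp hEg0 hh0 ht0)
  have htopBi : Integrable topB := htopBc.integrable_of_hasCompactSupport (hleafsupp hEb0 hh0 ht0)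
  have hbotEi : Integrable botE := hbotEc.integrable_of_hasCompactSupport (hleafsupp hEbot0 hF₁0 hs)
  have htopG0 : ∀ y, 0 ≤ topG y := hleafnn hEgnn h t
  have htopB0 : ∀ y, 0 ≤ topB y := hleafnn hEbnn h t
  have hbotE0 : ∀ y, 0 ≤ botE y := hleafnn hEbotnn F₁ s
  -- the flux integrands `topJ`, `botJ` are integrable too (continuous, compactly supported)
  have hJleafc : ∀ {F : E3 → ℝ}, ContDiff ℝ 1 F → ∀ τ : ℝ, Continuous fun y ↦ χ (T - (τ + F y)) *
      ∑ μ, f (E4.ofTimeSpace (τ + F y) y) * J (E4.ofTimeSpace (τ + F y) y) μ * graphConormal F y μ := by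
    intro F hFd τ
    have hFc' : Continuous F := hFd.continuous
    refine (hχc.comp (continuous_const.sub (continuous_const.add hFc'))).mul
      (continuous_finsetSum _ fun μ _ ↦ ?_)
    have h1 : Continuous fun x : E4 ↦ f x * J x μ :=
      continuous_mul_of_tsupport_subset hfU hfc fun x hx ↦ (hJU x hx μ).continuousAt
    have h2 : Continuous fun y : E3 ↦ graphConormal F y μ := by
      refine Fin.cases ?_ (fun i ↦ ?_) μ
      · simp only [graphConormal_zero]; exact continuous_const
      · simp only [graphConormal_succ, partialE3]
        exact ((hFd.continuous_fderiv one_ne_zero).clm_apply continuous_const).neg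
    exact (h1.comp (E4.continuous_ofTimeSpace' (continuous_const.add hFc') continuous_id)).mul h2
  have hJleafsupp : ∀ {F : E3 → ℝ}, (∀ y, 0 ≤ F y) → ∀ {τ : ℝ}, 0 ≤ τ →
      HasCompactSupport fun y ↦ χ (T - (τ + F y)) *
        ∑ μ, f (E4.ofTimeSpace (τ + F y) y) * J (E4.ofTimeSpace (τ + F y) y) μ * graphConormal F y μ := by
    intro F hF0 τ hτ
    refine HasCompactSupport.intro (isCompact_closedBall (0 : E3) (ρ₀ + T)) fun y hy ↦ ?_
    rw [mem_closedBall, dist_zero_right, not_le] at hy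
    rcases le_or_gt T (τ + F y) with hT | hT
    · have hz : χ (T - (τ + F y)) = 0 := Real.smoothTransition.zero_of_nonpos (by linarith)
      rw [hz, zero_mul]
    · have h0 : 0 ≤ (E4.ofTimeSpace (τ + F y) y) 0 := by
        rw [E4.ofTimeSpace_apply_zero]; linarith [hF0 y]
      have hfar' : ρ₀ + (E4.ofTimeSpace (τ + F y) y) 0 < E4.spatialNorm (E4.ofTimeSpace (τ + F y) y) := by
        rw [E4.ofTimeSpace_apply_zero, E4.spatialNorm_ofTimeSpace]; linarith
      simp [hJzero h0 hfar']
  have htopJi : Integrable topJ := (hJleafc hF1 t).integrable_of_hasCompactSupport (hJleafsupp hh0 ht0)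
  have hbotJi : Integrable botJ := (hJleafc hF₁1 s).integrable_of_hasCompactSupport (hJleafsupp hF₁0 hs)
  -- ### Step 5: the real inequality
  have hG₂nn : ∀ t' y, s + F₁ y < t' → t' ≤ t + h y → 0 ≤ G₂ t' y := by
    intro t' y _ _
    simp only [hG₂]
    set x := E4.ofTimeSpace t' y
    have hζ := hχ0 (T - t')
    have hζ' := hχ'0 (T - t')
    have k3 : 0 ≤ χ (T - t') * Coll x := mul_nonneg hζ (hCollnn x)
    by_cases hfx : f x = 0
    · rw [hfx]; simpa using k3
    · have hxR := hfar_of_ne x hfx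
      have k1 : 0 ≤ χ (T - t') * (f x * Db x) := mul_nonneg hζ (mul_nonneg (hf0 x) (hDbnn x hxR))
      have k2 : 0 ≤ deriv χ (T - t') * (f x * Pb x) := mul_nonneg hζ' (mul_nonneg (hf0 x) (hPbnn x hxR))
      linarith
  have hG₁nn : ∀ t' y, s + F₁ y < t' → t' ≤ t + h y → 0 ≤ G₁ t' y := by
    intro t' y _ _
    simp only [hG₁]
    set x := E4.ofTimeSpace t' y
    have hζ := hχ0 (T - t')
    have hζ' := hχ'0 (T - t')
    by_cases hfx : f x = 0
    · rw [hfx]; simp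
    · have hxR := hfar_of_ne x hfx
      have k1 : 0 ≤ χ (T - t') * (f x * Dg x) := mul_nonneg hζ (mul_nonneg (hf0 x) (hDgnn x hxR))
      have k2 : 0 ≤ deriv χ (T - t') * (f x * Pg x) := mul_nonneg hζ' (mul_nonneg (hf0 x) (hPgnn x hxR))
      linarith
  have hI₁nn : 0 ≤ ∫ y, ∫ t' in Ioc (s + F₁ y) (t + h y), G₁ t' y := by
    have := E4.integral_integral_Ioc_mono continuous_const hG₁c ha hb (fun _ _ _ _ h ↦ absurd rfl h)
      hsuppG₁ (fun t' y h1 h2 ↦ hG₁nn t' y h1 h2) (Φ₁ := fun _ _ ↦ (0 : ℝ)) (t₀ := 0) (t₁ := T) (ρ := ρ₀ + T)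
    simpa using this
  have hI₂nn : 0 ≤ ∫ y, ∫ t' in Ioc (s + F₁ y) (t + h y), G₂ t' y := by
    have := E4.integral_integral_Ioc_mono continuous_const hG₂c ha hb (fun _ _ _ _ h ↦ absurd rfl h)
      hsuppG₂ (fun t' y h1 h2 ↦ hG₂nn t' y h1 h2) (Φ₁ := fun _ _ ↦ (0 : ℝ)) (t₀ := 0) (t₁ := T) (ρ := ρ₀ + T)
    simpa using this
  have hreal : (∫ y, topG y) + ∫ y, ∫ t' in Ioc (s + F₁ y) (t + h y), G₁ t' y ≤
      (∫ y, botE y) + (∫ y, topB y) + ∫ y, ∫ t' in Ioc (s + F₁ y) (t + h y), G₂ t' y := by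
    have h1 : (∫ y, topG y) - ∫ y, topB y ≤ -∫ y, topJ y := by
      rw [← integral_sub htopGi htopBi, ← integral_neg]
      exact integral_mono (htopGi.sub htopBi) htopJi.neg fun y ↦ htop_pt y
    have h2 : -∫ y, botJ y ≤ ∫ y, botE y := by
      rw [← integral_neg]
      exact integral_mono hbotJi.neg hbotEi fun y ↦ hbot_pt y
    rw [hsplit] at hint
    linarith [hidE, hint, h1, h2]
  -- ### Step 6: conversion to `[0, ∞]`
  have hW := measurableSet_leafWedge hF₁c hhc s t
  -- leaf integrals
  have eTopG : ENNReal.ofReal (∫ y, topG y) = ∫⁻ y, ENNReal.ofReal (topG y) :=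
    ofReal_integral_eq_lintegral_ofReal htopGi (Eventually.of_forall htopG0)
  have eTopB : ENNReal.ofReal (∫ y, topB y) = ∫⁻ y, ENNReal.ofReal (topB y) :=
    ofReal_integral_eq_lintegral_ofReal htopBi (Eventually.of_forall htopB0)
  have eBotE : ENNReal.ofReal (∫ y, botE y) = ∫⁻ y, ENNReal.ofReal (botE y) :=
    ofReal_integral_eq_lintegral_ofReal hbotEi (Eventually.of_forall hbotE0)
  -- space-time integrals: `G₁` splits into its two non-negative parts, `G₂` into three
  have hmeas_fd : ∀ {d : E4 → ℝ}, (∀ x : E4, afRadius a (rPlus M a) < E4.spatialNorm x → ContinuousAt d x) →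
      ∀ (c : ℝ → ℝ), Continuous c →
        Measurable fun x : E4 ↦ ENNReal.ofReal (c (T - x 0) * (f x * d x)) := by
    intro d hd c hc
    exact ENNReal.measurable_ofReal.comp
      (((hc.comp (continuous_const.sub (E4.dx 0).continuous)).mul (hcont_fd hd)).measurable)
  have hconv : ∀ {g : E4 → ℝ}, Continuous g →
      (∀ x : E4, R' ≤ E4.spatialNorm x ∨ f x = 0 → 0 ≤ g x) →
      (∀ t' y, s + F₁ y < t' → t' ≤ t + h y → g (E4.ofTimeSpace t' y) ≠ 0 → t' ∈ Icc 0 T ∧ ‖y‖ ≤ ρ₀ + T) →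
      ENNReal.ofReal (∫ y, ∫ t' in Ioc (s + F₁ y) (t + h y), g (E4.ofTimeSpace t' y)) =
        ∫⁻ x in leafWedge F₁ h s t, ENNReal.ofReal (g x) := by
    intro g hgc hgnn hgsupp
    have hgc' : Continuous (Function.uncurry fun t' y ↦ g (E4.ofTimeSpace t' y)) :=
      hgc.comp E4.continuous_ofTimeSpace_uncurry
    have hgnn' : ∀ t' y, s + F₁ y < t' → t' ≤ t + h y → 0 ≤ g (E4.ofTimeSpace t' y) := by
      intro t' y _ _
      by_cases hfx : f (E4.ofTimeSpace t' y) = 0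
      · exact hgnn _ (Or.inr hfx)
      · exact hgnn _ (Or.inl (hfar_of_ne _ hfx))
    rw [E4.ofReal_integral_integral_Ioc_eq_lintegral hgc' ha hb hgsupp hgnn',
      show (fun p : ℝ × E3 ↦ ENNReal.ofReal (Function.uncurry (fun t' y ↦ g (E4.ofTimeSpace t' y)) p)) =
        fun p ↦ (fun x ↦ ENNReal.ofReal (g x)) (E4.ofTimeSpace p.1 p.2) from rfl,
      E4.lintegral_lintegral_indicator_eq_setLIntegral_leafWedge (g := fun x ↦ ENNReal.ofReal (g x))
        (ENNReal.measurable_ofReal.comp hgc.measurable) hF₁c hhc s t]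
  -- the five space-time pieces as functions on `E4`
  set gDg : E4 → ℝ := fun x ↦ χ (T - x 0) * (f x * Dg x) with hgDg
  set gPg : E4 → ℝ := fun x ↦ deriv χ (T - x 0) * (f x * Pg x) with hgPg
  set gDb : E4 → ℝ := fun x ↦ χ (T - x 0) * (f x * Db x) with hgDb
  set gPb : E4 → ℝ := fun x ↦ deriv χ (T - x 0) * (f x * Pb x) with hgPb
  set gC : E4 → ℝ := fun x ↦ χ (T - x 0) * Coll x with hgC
  have cDg : Continuous gDg := hζxc.mul (hcont_fd hDgc)
  have cPg : Continuous gPg := hζ'xc.mul (hcont_fd hPgc)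
  have cDb : Continuous gDb := hζxc.mul (hcont_fd hDbc)
  have cPb : Continuous gPb := hζ'xc.mul (hcont_fd hPbc)
  have cC : Continuous gC := hζxc.mul hCollc
  have nn_of : ∀ {d : E4 → ℝ} (c : ℝ → ℝ), (∀ σ, 0 ≤ c σ) → (∀ x : E4, R' ≤ E4.spatialNorm x → 0 ≤ d x) →
      ∀ x : E4, R' ≤ E4.spatialNorm x ∨ f x = 0 → 0 ≤ c (T - x 0) * (f x * d x) := by
    intro d c hc hd x hx
    rcases hx with hx | hx
    · exact mul_nonneg (hc _) (mul_nonneg (hf0 x) (hd x hx))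
    · rw [hx, zero_mul, mul_zero]
  have nDg := nn_of (d := Dg) χ hχ0 hDgnn
  have nPg := nn_of (d := Pg) (deriv χ) hχ'0 hPgnn
  have nDb := nn_of (d := Db) χ hχ0 hDbnn
  have nPb := nn_of (d := Pb) (deriv χ) hχ'0 hPbnn
  have nC : ∀ x : E4, R' ≤ E4.spatialNorm x ∨ f x = 0 → 0 ≤ gC x := fun x _ ↦
    mul_nonneg (hχ0 _) (hCollnn x)
  have supp_of : ∀ {d : E4 → ℝ}, (∀ x : E4, Φ x = 0 → fderiv ℝ Φ x = 0 → d x = 0) →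
      ∀ (c : ℝ → ℝ), (c = χ ∨ c = deriv χ) →
      ∀ t' y, s + F₁ y < t' → t' ≤ t + h y →
        c (T - (E4.ofTimeSpace t' y) 0) * (f (E4.ofTimeSpace t' y) * d (E4.ofTimeSpace t' y)) ≠ 0 →
          t' ∈ Icc 0 T ∧ ‖y‖ ≤ ρ₀ + T := by
    intro d hd c hc t' y h1 _ hne
    rw [E4.ofTimeSpace_apply_zero] at hne
    rcases hc with rfl | rfl
    · exact hsupp_of hd (fun t' y ↦ f (E4.ofTimeSpace t' y)) t' y h1 (Or.inl hne)
    · exact hsupp_of hd (fun t' y ↦ f (E4.ofTimeSpace t' y)) t' y h1 (Or.inr hne)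
  have sDg := supp_of hDg0 χ (Or.inl rfl)
  have sPg := supp_of hPg0 (deriv χ) (Or.inr rfl)
  have sDb := supp_of hDb0 χ (Or.inl rfl)
  have sPb := supp_of hPb0 (deriv χ) (Or.inr rfl)
  have sC : ∀ t' y, s + F₁ y < t' → t' ≤ t + h y → gC (E4.ofTimeSpace t' y) ≠ 0 →
      t' ∈ Icc 0 T ∧ ‖y‖ ≤ ρ₀ + T := by
    intro t' y h1 _ hne
    simp only [hgC, E4.ofTimeSpace_apply_zero] at hne
    refine hsupp_of hColl0 (fun _ _ ↦ 1) t' y h1 (Or.inl ?_)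
    simpa using hne
  have eDg := hconv cDg nDg sDg
  have ePg := hconv cPg nPg sPg
  have eDb := hconv cDb nDb sDb
  have ePb := hconv cPb nPb sPb
  have eC := hconv cC nC sC
  -- real splitting of `∫∫ G₁` and `∫∫ G₂`
  have cu : ∀ {g : E4 → ℝ}, Continuous g → Continuous (Function.uncurry fun t' y ↦ g (E4.ofTimeSpace t' y)) :=
    fun hg ↦ hg.comp E4.continuous_ofTimeSpace_uncurry
  have hsuppR : ∀ {g : E4 → ℝ},
      (∀ t' y, s + F₁ y < t' → t' ≤ t + h y → g (E4.ofTimeSpace t' y) ≠ 0 → t' ∈ Icc 0 T ∧ ‖y‖ ≤ ρ₀ + T) →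
      ∀ t' y, s + F₁ y < t' → t' ≤ t + h y → (fun t' y ↦ g (E4.ofTimeSpace t' y)) t' y ≠ 0 →
        t' ∈ Icc 0 T ∧ ‖y‖ ≤ ρ₀ + T := fun hg ↦ hg
  have hintR : ∀ {g : E4 → ℝ}, Continuous g →
      (∀ t' y, s + F₁ y < t' → t' ≤ t + h y → g (E4.ofTimeSpace t' y) ≠ 0 → t' ∈ Icc 0 T ∧ ‖y‖ ≤ ρ₀ + T) →
      Integrable ({p : ℝ × E3 | s + F₁ p.2 < p.1 ∧ p.1 ≤ t + h p.2}.indicator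
        (Function.uncurry fun t' y ↦ g (E4.ofTimeSpace t' y))) ((volume : Measure ℝ).prod (volume : Measure E3)) :=
    fun hgc hg ↦ E4.integrable_indicator_wedge (cu hgc) ha hb hg
  have hG₁split : ∫ y, ∫ t' in Ioc (s + F₁ y) (t + h y), G₁ t' y =
      (∫ y, ∫ t' in Ioc (s + F₁ y) (t + h y), gDg (E4.ofTimeSpace t' y)) +
        ∫ y, ∫ t' in Ioc (s + F₁ y) (t + h y), gPg (E4.ofTimeSpace t' y) := by
    rw [E4.integral_integral_Ioc_eq_integral_indicator hG₁c ha hb hsuppG₁,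
      E4.integral_integral_Ioc_eq_integral_indicator (cu cDg) ha hb sDg,
      E4.integral_integral_Ioc_eq_integral_indicator (cu cPg) ha hb sPg,
      ← integral_add (hintR cDg sDg) (hintR cPg sPg)]
    refine integral_congr_ae (Eventually.of_forall fun p ↦ ?_)
    by_cases hp : p ∈ {p : ℝ × E3 | s + F₁ p.2 < p.1 ∧ p.1 ≤ t + h p.2}
    · simp only [indicator_of_mem hp, Function.uncurry, hG₁, hgDg, hgPg, E4.ofTimeSpace_apply_zero]
    · simp only [indicator_of_notMem hp, add_zero]
  have hG₂split : ∫ y, ∫ t' in Ioc (s + F₁ y) (t + h y), G₂ t' y =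
      (∫ y, ∫ t' in Ioc (s + F₁ y) (t + h y), gDb (E4.ofTimeSpace t' y)) +
        (∫ y, ∫ t' in Ioc (s + F₁ y) (t + h y), gPb (E4.ofTimeSpace t' y)) +
        ∫ y, ∫ t' in Ioc (s + F₁ y) (t + h y), gC (E4.ofTimeSpace t' y) := by
    rw [E4.integral_integral_Ioc_eq_integral_indicator hG₂c ha hb hsuppG₂,
      E4.integral_integral_Ioc_eq_integral_indicator (cu cDb) ha hb sDb,
      E4.integral_integral_Ioc_eq_integral_indicator (cu cPb) ha hb sPb,
      E4.integral_integral_Ioc_eq_integral_indicator (cu cC) ha hb sC,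
      ← integral_add (hintR cDb sDb) (hintR cPb sPb), ← integral_add _ (hintR cC sC)]
    · refine integral_congr_ae (Eventually.of_forall fun p ↦ ?_)
      by_cases hp : p ∈ {p : ℝ × E3 | s + F₁ p.2 < p.1 ∧ p.1 ≤ t + h p.2}
      · simp only [indicator_of_mem hp, Function.uncurry, hG₂, hgDb, hgPb, hgC, E4.ofTimeSpace_apply_zero]
      · simp only [indicator_of_notMem hp, add_zero]
    · exact (hintR cDb sDb).add (hintR cPb sPb)
  -- non-negativity of the real pieces
  have nnR : ∀ {g : E4 → ℝ}, Continuous g → (∀ x : E4, R' ≤ E4.spatialNorm x ∨ f x = 0 → 0 ≤ g x) →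
      (∀ t' y, s + F₁ y < t' → t' ≤ t + h y → g (E4.ofTimeSpace t' y) ≠ 0 → t' ∈ Icc 0 T ∧ ‖y‖ ≤ ρ₀ + T) →
      0 ≤ ∫ y, ∫ t' in Ioc (s + F₁ y) (t + h y), g (E4.ofTimeSpace t' y) := by
    intro g hgc hgnn hg
    have hgnn' : ∀ t' y, s + F₁ y < t' → t' ≤ t + h y →
        (fun _ _ ↦ (0 : ℝ)) t' y ≤ (fun t' y ↦ g (E4.ofTimeSpace t' y)) t' y := by
      intro t' y _ _
      by_cases hfx : f (E4.ofTimeSpace t' y) = 0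
      · exact hgnn _ (Or.inr hfx)
      · exact hgnn _ (Or.inl (hfar_of_ne _ hfx))
    have := E4.integral_integral_Ioc_mono continuous_const (cu hgc) ha hb
      (fun _ _ _ _ h ↦ absurd rfl h) hg hgnn' (t₀ := 0) (t₁ := T) (ρ := ρ₀ + T)
    simpa using this
  have rDg := nnR cDg nDg sDg
  have rPg := nnR cPg nPg sPg
  have rDb := nnR cDb nDb sDb
  have rPb := nnR cPb nPb sPb
  have rC := nnR cC nC sC
  have rTopG : 0 ≤ ∫ y, topG y := integral_nonneg htopG0
  have rTopB : 0 ≤ ∫ y, topB y := integral_nonneg htopB0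
  have rBotE : 0 ≤ ∫ y, botE y := integral_nonneg hbotE0
  -- assemble in `[0, ∞]`
  rw [hG₁split, hG₂split] at hreal
  have key := ENNReal.ofReal_le_ofReal hreal
  rw [ENNReal.ofReal_add rTopG (add_nonneg rDg rPg), ENNReal.ofReal_add rDg rPg,
    ENNReal.ofReal_add (add_nonneg rBotE rTopB) (add_nonneg (add_nonneg rDb rPb) rC),
    ENNReal.ofReal_add rBotE rTopB, ENNReal.ofReal_add (add_nonneg rDb rPb) rC, ENNReal.ofReal_add rDb rPb,
    eTopG, eTopB, eBotE, eDg, ePg, eDb, ePb, eC] at key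
  simpa only [htopG, htopB, hbotE, hgDg, hgPg, hgDb, hgPb, hgC, hfval, add_assoc] using key

end Kerr

end Literature.Geometry.Lorentzian
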